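import Mathlib
import HarnessLib
import Literature.MathematicalPhysics.KineticTheory.HardSphereEulerProofs
import Summits.AtomisticToContinuum.HydrodynamicLimit.Theses.OneFlightGossipEngine
import Summits.AtomisticToContinuum.HydrodynamicLimit.Theorems.OneFlightGossipEngineKineticCurrentsLDAlongFamiliesTransferByNets

/-!
# Family window tails from pointwise radial tails — stub `stub_windowTailsFamily_of_pointwise`
# (S9) of line `Sketch`, crux `KineticCurrentsLDAlongFamilies` (stmt-AtomisticToContinuum-16659)

Route `OneFlightGossipEngine`, sub-problem `HydrodynamicLimit`, stub S9 of the skeleton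
`Cruxes/KineticCurrentsLDAlongFamilies/Lines/Sketch.lean` (v5, radial reshape). Static glue: from
exponential tightness of the window-averaged suprathermal kinetic energy
`Σᵢ w⁻¹∫₀ʷ max 0 (‖vᵢ(r)‖² − V) dr`, `w = τ(N+1)^{-1/3}`, under the local Gibbs law of ONE profile
with thresholds `γ₀(Θ,U,Λ,σ)`, `V(…,γ,κ)` numeric in the profile bounds (hypothesis `hP`, output of
S10) to the same tightness UNIFORMLY along a jointly continuous family `s ↦ (a_s, θ₀,s, u₀,s)`,
`s ∈ [0, t₁]`, eventually in `τ`. The tail observable does not depend on `s`, so only the LAW is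
moved: by the static change of reference law (hypothesis `hR`, S5)
`∫ g dλ_{s'} ≤ (∫ g² dλ_{s_k})^{1/2} e^{κ(N+1)/4}` for `|s_k − s'| ≤ δ`, with
`g = exp(γ Σᵢ w⁻¹∫₀ʷ max 0 (‖vᵢ‖² − V))`, `g²` the same functional at tilt `2γ`, and `hP` at the
finitely many nodes `s_k = min(t₁, kδ)` of a `δ`-net with tilt `2γ` and precision `κ/2`; the numeric
bounds of the family on `[0, t₁]` come from the family modulus (hypothesis `hB`, S6) with zero
weights, and `η := min(η^{S10}, 1/8)` makes the packing guard give `σ ≤ 1/2`. Thresholds are merged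
over the net by `tbn_net_thresholds`.

References: S. Olla, S. R. S. Varadhan, H.-T. Yau, Comm. Math. Phys. 155 (1993) §2 (exponential
moment currency, change of reference law); H. Spohn, *Large Scale Dynamics of Interacting
Particles* (1991), Part I §2.3.
-/

noncomputable section

open MeasureTheory Set Filter
open scoped ENNReal Topology

namespace Summit.AtomisticToContinuum.HydrodynamicLimit.Theorems.KineticCurrentsLDAlongFamiliesSketch

open Literature.Analysis.FluidPDE (HardSphereFlow Config localMaxwellian canonicalDensity liouville)
open Literature.MathematicalPhysics.KineticTheory (T3 V3 hsDiameter localGibbsLaw localGibbsMeasure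
  localGibbsProfile)
open Literature.Analysis.FluidPDE Literature.MathematicalPhysics.KineticTheory

/-- Squaring an exponential density doubles the tilt: `(e^{x})² = e^{2x}` in `ℝ≥0∞`. [folklore] -/
theorem wtp_ofReal_exp_sq (x : ℝ) :
    ENNReal.ofReal (Real.exp x) ^ 2 = ENNReal.ofReal (Real.exp (2 * x)) := by
  rw [← ENNReal.ofReal_pow (Real.exp_nonneg _), ← Real.exp_nat_mul, Nat.cast_ofNat]

/-- The square root of an exponential bound halves the exponent: `(e^{x})^{1/2} = e^{x/2}` in
`ℝ≥0∞`. [folklore] -/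
theorem wtp_ofReal_exp_rpow_half (x : ℝ) :
    ENNReal.ofReal (Real.exp x) ^ (1 / 2 : ℝ) = ENNReal.ofReal (Real.exp (x / 2)) := by
  rw [ENNReal.ofReal_rpow_of_nonneg (Real.exp_pos _).le (by norm_num), ← Real.exp_mul]
  congr 2
  ring

/-- **The arithmetic of the chain** in `ℝ≥0∞`: `I ≤ J^{1/2} e^{κn/4}`, `J ≤ e^{κn/2}`, `n ≥ 0`,
`κ ≥ 0` give `I ≤ e^{κn}` (indeed `I ≤ e^{κn/4} e^{κn/4} = e^{κn/2} ≤ e^{κn}`). [folklore] -/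
theorem wtp_chain_le {I J : ℝ≥0∞} {n κ : ℝ}
    (ha : I ≤ J ^ (1 / 2 : ℝ) * ENNReal.ofReal (Real.exp (κ / 4 * n)))
    (hb : J ≤ ENNReal.ofReal (Real.exp (κ / 2 * n))) (hn : 0 ≤ n) (hκ : 0 ≤ κ) :
    I ≤ ENNReal.ofReal (Real.exp (κ * n)) := by
  calc I ≤ J ^ (1 / 2 : ℝ) * ENNReal.ofReal (Real.exp (κ / 4 * n)) := ha
    _ ≤ (ENNReal.ofReal (Real.exp (κ / 2 * n))) ^ (1 / 2 : ℝ) *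
          ENNReal.ofReal (Real.exp (κ / 4 * n)) :=
        mul_le_mul' (ENNReal.rpow_le_rpow hb (by norm_num)) le_rfl
    _ = ENNReal.ofReal (Real.exp (κ / 2 * n)) := by
        rw [wtp_ofReal_exp_rpow_half, ← ENNReal.ofReal_mul (Real.exp_pos _).le, ← Real.exp_add]
        congr 2
        ring
    _ ≤ ENNReal.ofReal (Real.exp (κ * n)) :=
        ENNReal.ofReal_le_ofReal (Real.exp_le_exp.2
          (mul_le_mul_of_nonneg_right (by linarith) hn))

/-- **S9 — family window tails from pointwise radial tails** (stub
`stub_windowTailsFamily_of_pointwise` of line `Sketch`, crux `KineticCurrentsLDAlongFamilies`,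
stmt-AtomisticToContinuum-16659): the pointwise window tails with thresholds numeric in the profile
bounds (S10, hypothesis), the static change of reference law along the family (S5, hypothesis) and
the family bounds (S6 with zero weights, hypothesis) give the window tails uniformly in
`s ∈ [0, t₁]`, eventually in `τ`. `η := min(η^{S10}, 1/8)`; `γ₀ := γ₀^{S10}(Θ,U,Λ,σ)/2`;
`V := V^{S10}(2γ, κ/2)`; `δ` from S5 at precision `κ/4`; nodes `s_k = min(t₁, kδ)`,
`k ≤ ⌈t₁/δ⌉`; `τ₀ := Σ_k τ₀(k) + 1`, `N₀ := Σ_k N₀(k, τ)`; for `s'` and `k = ⌊s'/δ⌋`: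
`∫ g dλ_{s'} ≤ (∫ g² dλ_{s_k})^{1/2} e^{κ(N+1)/4} ≤ e^{κ(N+1)/4} e^{κ(N+1)/4} ≤ e^{κ(N+1)}`. [folklore] -/
theorem stub_windowTailsFamily_of_pointwise :
    (∃ η : ℝ, 0 < η ∧ ∀ (Θ U Λ : ℝ), 1 ≤ Θ → 0 ≤ U → 1 ≤ Λ → ∀ σ : ℝ, 0 < σ →
        ∃ γ₀ : ℝ, 0 < γ₀ ∧ ∀ γ : ℝ, 0 ≤ γ → γ ≤ γ₀ → ∀ κ : ℝ, 0 < κ → ∃ V : ℝ, 1 ≤ V ∧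
        ∀ (a θ₀ : T3 → ℝ) (u₀ : T3 → V3), Continuous a → Continuous θ₀ → Continuous u₀ →
        (∀ x, Λ⁻¹ ≤ a x ∧ a x ≤ Λ) → (∀ x, Θ⁻¹ ≤ θ₀ x ∧ θ₀ x ≤ Θ) → (∀ x, ‖u₀ x‖ ≤ U) →
        σ ^ 3 * (⨆ x, a x) ≤ η * ∫ x, a x →
        ∀ Φ : (N : ℕ) → HardSphereFlow (Torus.geometry (Fin 3)) (hsDiameter σ N) (N + 1),
        ∃ τ₀ : ℝ, 0 < τ₀ ∧ ∀ τ : ℝ, τ₀ ≤ τ → ∃ N₀ : ℕ, ∀ N : ℕ, N₀ ≤ N →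
          ∫⁻ z, ENNReal.ofReal (Real.exp (γ * ∑ i : Fin (N + 1),
              (τ * ((N : ℝ) + 1) ^ (-(1 / 3 : ℝ)))⁻¹ *
                ∫ r in (0 : ℝ)..(τ * ((N : ℝ) + 1) ^ (-(1 / 3 : ℝ))),
                  max 0 (‖(((Φ N).flow r z) i).2‖ ^ 2 - V)))
            ∂(localGibbsLaw σ a u₀ θ₀ N (Φ N)) ≤
          ENNReal.ofReal (Real.exp (κ * ((N : ℝ) + 1)))) →
    (∀ (t₁ : ℝ) (a θ₀ : ℝ → T3 → ℝ) (u₀ : ℝ → T3 → V3),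
        Continuous (Function.uncurry a) → Continuous (Function.uncurry θ₀) →
        Continuous (Function.uncurry u₀) → (∀ s x, 0 < a s x) → (∀ s x, 0 < θ₀ s x) →
        ∀ σ : ℝ, 0 < σ → σ ≤ 1 / 2 → ∀ κ : ℝ, 0 < κ → ∃ δ : ℝ, 0 < δ ∧
        ∀ Φ : (N : ℕ) → HardSphereFlow (Torus.geometry (Fin 3)) (hsDiameter σ N) (N + 1),
        ∀ N : ℕ, ∀ s ∈ Icc 0 t₁, ∀ s' ∈ Icc 0 t₁, |s - s'| ≤ δ →
        ∀ g : Config (N + 1) (Fin 3) T3 → ℝ≥0∞,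
          AEMeasurable g (liouville (Torus.geometry (Fin 3)) (N + 1) (hsDiameter σ N)) →
          ∫⁻ z, g z ∂(localGibbsLaw σ (a s') (u₀ s') (θ₀ s') N (Φ N)) ≤
            (∫⁻ z, g z ^ 2 ∂(localGibbsLaw σ (a s) (u₀ s) (θ₀ s) N (Φ N))) ^ (1 / 2 : ℝ) *
              ENNReal.ofReal (Real.exp (κ * ((N : ℝ) + 1)))) →
    (∀ (t₁ : ℝ) (a θ₀ : ℝ → T3 → ℝ) (u₀ : ℝ → T3 → V3),
        Continuous (Function.uncurry a) → Continuous (Function.uncurry θ₀) →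
        Continuous (Function.uncurry u₀) → (∀ s x, 0 < a s x) → (∀ s x, 0 < θ₀ s x) →
        ∀ (A : ℝ → T3 → Fin 3 → Fin 3 → ℝ) (b : ℝ → T3 → V3) (G : ℝ → T3 × ℝ → ℝ),
        Continuous (Function.uncurry A) → Continuous (Function.uncurry b) →
        Continuous (Function.uncurry G) →
        ∀ F : ℝ → T3 × V3 → ℝ, (∀ s y, F s y =
          (∑ j : Fin 3, ∑ k : Fin 3, A s y.1 j k * ((y.2 - u₀ s y.1) j * (y.2 - u₀ s y.1) k)) +
            (∑ j : Fin 3, b s y.1 j * (y.2 - u₀ s y.1) j) * G s (y.1, ‖y.2 - u₀ s y.1‖ ^ 2)) →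
        ∃ Θ U Λ : ℝ, 1 ≤ Θ ∧ 0 ≤ U ∧ 1 ≤ Λ ∧
          (∀ s ∈ Icc 0 t₁, ∀ x, Θ⁻¹ ≤ θ₀ s x ∧ θ₀ s x ≤ Θ) ∧
          (∀ s ∈ Icc 0 t₁, ∀ x, ‖u₀ s x‖ ≤ U) ∧
          (∀ s ∈ Icc 0 t₁, ∀ x, Λ⁻¹ ≤ a s x ∧ a s x ≤ Λ) ∧
          ∀ R : ℝ, ∀ ω : ℝ, 0 < ω → ∃ δ : ℝ, 0 < δ ∧
            ∀ s ∈ Icc 0 t₁, ∀ s' ∈ Icc 0 t₁, |s - s'| ≤ δ →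
            ∀ (x : T3) (v : V3), ‖v‖ ≤ R → |F s (x, v) - F s' (x, v)| ≤ ω) →
    ∃ η : ℝ, 0 < η ∧ ∀ (t₁ : ℝ) (a θ₀ : ℝ → T3 → ℝ) (u₀ : ℝ → T3 → V3),
        Continuous (Function.uncurry a) → Continuous (Function.uncurry θ₀) →
        Continuous (Function.uncurry u₀) → (∀ s x, 0 < a s x) → (∀ s x, 0 < θ₀ s x) →
        ∀ σ : ℝ, 0 < σ → (∀ s ∈ Icc 0 t₁, σ ^ 3 * (⨆ x, a s x) ≤ η * ∫ x, a s x) →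
        ∀ Φ : (N : ℕ) → HardSphereFlow (Torus.geometry (Fin 3)) (hsDiameter σ N) (N + 1),
        ∃ γ₀ : ℝ, 0 < γ₀ ∧ ∀ γ : ℝ, 0 ≤ γ → γ ≤ γ₀ → ∀ κ : ℝ, 0 < κ → ∃ V : ℝ, 1 ≤ V ∧
        ∃ τ₀ : ℝ, 0 < τ₀ ∧ ∀ τ : ℝ, τ₀ ≤ τ → ∃ N₀ : ℕ, ∀ N : ℕ, N₀ ≤ N → ∀ s ∈ Icc 0 t₁,
          ∫⁻ z, ENNReal.ofReal (Real.exp (γ * ∑ i : Fin (N + 1),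
              (τ * ((N : ℝ) + 1) ^ (-(1 / 3 : ℝ)))⁻¹ *
                ∫ r in (0 : ℝ)..(τ * ((N : ℝ) + 1) ^ (-(1 / 3 : ℝ))),
                  max 0 (‖(((Φ N).flow r z) i).2‖ ^ 2 - V)))
            ∂(localGibbsLaw σ (a s) (u₀ s) (θ₀ s) N (Φ N)) ≤
          ENNReal.ofReal (Real.exp (κ * ((N : ℝ) + 1))) := by
  rintro ⟨ηP, hηP, hP'⟩ hR hB
  refine ⟨min ηP (1 / 8), lt_min hηP (by norm_num), ?_⟩
  intro t₁ a θ₀ u₀ ha hθ hu ha0 hθ0 σ hσ hguard Φ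
  -- the degenerate parameter interval `t₁ < 0`: everything is vacuous
  by_cases ht : t₁ < 0
  · refine ⟨1, one_pos, fun γ _ _ κ _ => ⟨1, le_rfl, 1, one_pos, fun τ _ => ⟨0, ?_⟩⟩⟩
    exact fun N _ s hs => absurd (hs.1.trans hs.2) (not_le.2 ht)
  replace ht : 0 ≤ t₁ := not_lt.1 ht
  have h0 : (0 : ℝ) ∈ Icc 0 t₁ := ⟨le_rfl, ht⟩
  -- Step 1: the guard gives `σ ≤ 1/2` (at `s = 0`) and the S10-guard at level `ηP` at every `s`
  have hint_le : ∀ s, ∫ x, a s x ≤ ⨆ x, a s x := fun s =>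
    KineticCurrentsWindowLDUniformSketch.integral_le_iSup_T3 (ha.uncurry_left s)
  have hint_nn : ∀ s, 0 ≤ ∫ x, a s x := fun s => integral_nonneg fun x => (ha0 s x).le
  have hguardP : ∀ s ∈ Icc 0 t₁, σ ^ 3 * (⨆ x, a s x) ≤ ηP * ∫ x, a s x := fun s hs =>
    (hguard s hs).trans (mul_le_mul_of_nonneg_right (min_le_left _ _) (hint_nn s))
  have hσ2 : σ ≤ 1 / 2 := by
    have h8 : σ ^ 3 * (⨆ x, a 0 x) ≤ 1 / 8 * (⨆ x, a 0 x) :=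
      (hguard 0 h0).trans ((mul_le_mul_of_nonneg_right (min_le_right _ _) (hint_nn 0)).trans
        (mul_le_mul_of_nonneg_left (hint_le 0) (by norm_num)))
    have hsup_pos : 0 < ⨆ x, a 0 x :=
      lt_of_lt_of_le (ha0 0 0) (le_ciSup (isCompact_range (ha.uncurry_left 0)).bddAbove 0)
    have h8' : σ ^ 3 ≤ (1 / 2) ^ 3 := by nlinarith
    exact le_of_pow_le_pow_left₀ (by norm_num) (by norm_num) h8'
  -- Step 2: the numeric bounds of the family on `[0, t₁]` (S6 with the zero weights)
  obtain ⟨Θ, U, Λ, hΘ1, hU0, hΛ1, hΘb, hUb, hΛb, -⟩ :=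
    hB t₁ a θ₀ u₀ ha hθ hu ha0 hθ0 (fun _ _ => 0) (fun _ _ => 0) (fun _ _ => 0)
      continuous_const continuous_const continuous_const (fun _ _ => 0) (fun s y => by simp)
  -- Step 3: the thresholds of the pointwise tails (S10): `γ₁(Θ,U,Λ,σ)`, then the level `V` at
  -- tilt `2γ` and precision `κ/2`
  obtain ⟨γ₁, hγ₁, hP1⟩ := hP' Θ U Λ hΘ1 hU0 hΛ1 σ hσ
  refine ⟨γ₁ / 2, by positivity, ?_⟩
  intro γ hγ0 hγ κ hκ
  obtain ⟨V, hV1, hP2⟩ := hP1 (2 * γ) (by positivity) (by linarith) (κ / 2) (by positivity)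
  refine ⟨V, hV1, ?_⟩
  -- Step 4: the static change of reference law (S5) at precision `κ/4`
  obtain ⟨δ, hδ, hlaw⟩ := hR t₁ a θ₀ u₀ ha hθ hu ha0 hθ0 σ hσ hσ2 (κ / 4) (by positivity)
  -- Step 5: the net `s_k = min t₁ (kδ)` and the pointwise tails (S10) at every node, tilt `2γ`
  obtain ⟨sk, hsk, hsk_eq⟩ : ∃ sk : ℕ → ℝ, (∀ k, sk k ∈ Icc 0 t₁) ∧
      ∀ k : ℕ, (k : ℝ) * δ ≤ t₁ → sk k = k * δ :=
    ⟨fun k => min t₁ (k * δ), fun k => ⟨le_min ht (by positivity), min_le_left _ _⟩,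
      fun k hk => min_eq_right hk⟩
  have hnet := fun k : ℕ =>
    hP2 (a (sk k)) (θ₀ (sk k)) (u₀ (sk k)) (ha.uncurry_left _) (hθ.uncurry_left _)
      (hu.uncurry_left _) (hΛb _ (hsk k)) (hΘb _ (hsk k)) (hUb _ (hsk k)) (hguardP _ (hsk k)) Φ
  obtain ⟨τ₀, hτ₀, hnet'⟩ := tbn_net_thresholds (Finset.range (⌈t₁ / δ⌉₊ + 1)) hnet
  refine ⟨τ₀, hτ₀, fun τ hτ => ?_⟩
  obtain ⟨N₁, hN₁⟩ := hnet' τ hτ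
  refine ⟨N₁, fun N hN s' hs' => ?_⟩
  -- Step 6: the nearest node to the left of `s'`
  obtain ⟨k, hkδ, hs'k, hk_mem⟩ : ∃ k : ℕ, (k : ℝ) * δ ≤ s' ∧ s' < k * δ + δ ∧
      k ∈ Finset.range (⌈t₁ / δ⌉₊ + 1) := by
    refine ⟨⌊s' / δ⌋₊, ?_, ?_, ?_⟩
    · have h := Nat.floor_le (div_nonneg hs'.1 hδ.le)
      rwa [le_div_iff₀ hδ] at h
    · have h := Nat.lt_floor_add_one (s' / δ)
      rw [div_lt_iff₀ hδ] at h
      linarith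
    · exact Finset.mem_range.2 (Nat.lt_add_one_iff.2 ((Nat.floor_le_ceil _).trans
        (Nat.ceil_le_ceil (div_le_div_of_nonneg_right hs'.2 hδ.le))))
  have hdist : |sk k - s'| ≤ δ := by
    rw [hsk_eq k (hkδ.trans hs'.2), abs_sub_comm, abs_of_nonneg (by linarith)]
    linarith
  -- Step 7: the tail density `g = exp(γ Σᵢ w⁻¹∫₀ʷ max 0 (‖vᵢ(r)‖² − V) dr)` is measurable
  have hY : Continuous fun y : T3 × V3 => max 0 (‖y.2‖ ^ 2 - V) :=
    continuous_const.max ((continuous_snd.norm.pow 2).sub continuous_const)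
  have hmeas : AEMeasurable (fun z => ENNReal.ofReal (Real.exp (γ * ∑ i,
      (τ * ((N : ℝ) + 1) ^ (-(1 / 3 : ℝ)))⁻¹ * ∫ r in (0 : ℝ)..(τ * ((N : ℝ) + 1) ^ (-(1 / 3 : ℝ))),
      max 0 (‖((Φ N).flow r z i).2‖ ^ 2 - V))))
      (liouville (Torus.geometry (Fin 3)) (N + 1) (hsDiameter σ N)) := by
    refine (Real.measurable_exp.comp_aemeasurable (AEMeasurable.const_mul
      (Finset.aemeasurable_fun_sum _ fun i _ => ?_) γ)).ennreal_ofReal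
    exact ((Φ N).aemeasurable_intervalIntegral_comp_flow_torus
      (hY.measurable.comp (measurable_pi_apply i)) 0 _ (Φ N).measure_compl_good).const_mul _
  -- Step 8: (a) change of reference law `λ_{s'} → λ_{s_k}` (S5); (b) `g²` is the tail density at
  -- tilt `2γ`, bounded at the node by S10; (c) `κ/4 + (κ/2)/2 ≤ κ`
  have haa := hlaw Φ N (sk k) (hsk k) s' hs' hdist _ hmeas
  refine wtp_chain_le haa (le_trans (le_of_eq (lintegral_congr fun z => ?_)) (hN₁ N hN k hk_mem))
    (by positivity) hκ.le
  rw [wtp_ofReal_exp_sq, mul_assoc]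

end Summit.AtomisticToContinuum.HydrodynamicLimit.Theorems.KineticCurrentsLDAlongFamiliesSketch

end
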